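import Summits.KontsevichZagierPeriods.KontsevichZagierPeriods.Theses.TorsionLogs
import Literature.NumberTheory.Transcendental.KZCalculusProofs

/-!
# Crux `TorsionSectorComplete` (stmt-KontsevichZagierPeriods-14212) — birth skeleton (`Lines/birth.lean`, BC3)

Route `TorsionLogs` (route-KontsevichZagierPeriods-TorsionLogs), rank-9 conjecture-grade crux
`Summit.KontsevichZagierPeriods.KontsevichZagierPeriods.Theses.TorsionLogs.TorsionSectorComplete`
(CLAIMED by the route; antecedent `h₂` of its deciding theorem `closes`): COMPLETENESS OF THE KZ
CALCULUS RELATIVE TO THE NÉRON–TORSION SECTOR — for rational representations `r`, `r'` of equal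
value, `[r] − [r'] ∈ KZ.relations ⊔ closure T`, where `T` is the set of tied Néron–torsion elements
`M•[rI] + k•[rP] − m•[rL]` (hypotheses of `NeronTorsionSector` rev 2 repeated verbatim, tie
`4N²k = M(N−2a)²` and value hypothesis included). The refuter's crux-attack (evidence
`CruxAttack.lean`, 2026-08-16) records: the crux is the summit modulo the sector
(`of_summit`, `iff_summit_of_sector`), its kernel form is `ker eval ≤ relations ⊔ closure T`
(`iff_ker_le`), and no cheap kill exists (`summit_false_of_not`). No `Disproof.lean`, no `Negative/`
lemma and no dead line exist for this crux (`ledger crux ls`: no workfiles before this one), so there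
is no `_false_without_` obstruction to honour; the summit's negatives index (1 entry, stmt-5394
KinematicFormulas) is unrelated.

## The cut: rational dimension two — the SURFACE LAYER, where the sector lives

Every generator of `T` is supported in dimension `≤ 2` (`rI`, `rP : KZ.IntegralRep 2` are the
length-two iterated integrals on `E × E`, `rL : KZ.IntegralRep 1` the logarithm), so
`closure T ≤ S₂ := closure {[s] | s : KZ.IntegralRep k, k ≤ 2}` — the **surface layer** of the formal
group (PROVED below, `closure_tied_le_surfaceLayer`). The surface layer is exactly where the route's
lever acts (Néron heights / biextension periods of an elliptic curve are 2-dimensional algebraic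
integrals; the planar areas = real 1-periods of Huber–Wüstholz, the elliptic period/quasi-period
ring of Chudnovsky, the dilogarithm/Clausen layer of HodgeLevel's `DimTwoRationalStratum` all live
here), while everything of Hodge level `≥ 3` (two representations of `ζ(3)`, MZVs of weight `≥ 3`,
the route's own 3-dimensional GKZ pairs) lies outside it: periods of pairs of dimension `≤ 2` carry
Hodge types `(p, q)` with `p, q ≤ 2` only. The skeleton cuts the crux (kernel form) along `S₂`:

* `stub_surfaceDescent` (conjecture-grade; crux-implied with `y = 0`, `surfaceDescent_of_crux`):
  every vanishing difference `[r] − [r']` of RATIONAL representations (any dimensions) is congruent,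
  modulo `relations ⊔ closure T`, to an element `y` of the surface layer — "whatever Conjecture 1
  does in Hodge level ≥ 3 it does up to a surface-layer remainder": DIMENSION DESCENT of vanishing
  pairs by moves. It is the complement of the layer in relative form (HodgeLevel's `RationalStrata`
  defers exactly this: "from d = 3 on it needs Grothendieck-strength rigidity").
* `stub_surfaceKernel` (conjecture-grade; crux-implied, `surfaceKernel_of_crux`, via the PROVED
  tree facts `KZ.exists_integralRep_sub_holds` + `KZ.exists_isRational_equivalent_holds` +
  soundness): every element of the surface layer with value `0` lies in `relations ⊔ closure T` —
  COMPLETENESS OF THE SURFACE-LAYER CALCULUS ENLARGED BY THE NÉRON–TORSION ELEMENTS. It implies the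
  `T`-relative form of HodgeLevel's open rank-2 item `DimTwoRationalStratum` (stmt-4280: rational
  `r`, `r'` of dimensions `≤ 2`) and contains the `T`-relative `PlanarAreas` (stmt-4990); its
  dimension-`≤ 1` rational shadow is the tree THEOREM `LowdimBaker0DimLeOne` (stmt-10622, Baker).

Composition `TorsionSectorComplete_of : TorsionSectorComplete` (real proof; the `suffices` line is
literally `<stub_surfaceDescent-sig> → <stub_surfaceKernel-sig> → TorsionSectorComplete`, applied
to the two stubs by name, as `#h21_check_skeleton` admits no inline `Prop` hypotheses):
`x = [r] − [r']` has `eval x = 0` (value hypothesis) ↦ descent gives `y ∈ S₂` with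
`x − y ∈ relations ⊔ closure T` ↦ SOUNDNESS OF THE ENLARGED CALCULUS (`enlarged_le_ker_eval`,
PROVED here: moves are sound, `KZ.relations_le_ker_eval_holds`, and every tied element evaluates to
`0` by its own value hypothesis, `closure_tied_le_ker_eval`) gives `eval y = 0` ↦ the surface
kernel puts `y` in `relations ⊔ closure T` ↦ so is `x = (x − y) + y`.

Neither stub is cheaply the crux or the summit (BC3 probes in the registrar's folder
`bc/probe_*.lean`, all rc ≠ 0 — quoted in NOTES.md): `stub_surfaceKernel → crux` needs descent
(open, GPC-strength in Hodge level ≥ 3) and `stub_surfaceDescent → crux` needs the surface kernel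
(open: it contains curved planar Hilbert III / Huber–Wüstholz transferred into the moves); neither
is a residual equivalent to the crux modulo proved theorems (contrast the Γ-sector lines of
`CompleteModGammaSector`, whose residuals absorb), and both are implied by the crux, hence
refutable only by refuting `KontsevichZagierPeriods`.

References: Kontsevich–Zagier 2001 §1.1–1.2 (Conjecture 1); Huber–Müller-Stach 2017 Ch. 12–13
(naive periods are periods of pairs; Prop. 13.2.6, Rem. 13.1.8); Huber–Wüstholz 2022 Thm 13.3
(1-periods); Deligne, Hodge II (Hodge types of `Hⁿ` of pairs of dimension `n`); tree: routes
HodgeLevel (stmt-4280, 4989, 4990, 10622), LowDimension, VeryGoodTransfer (the resolution cut, not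
used here), refuter evidence CruxAttack.lean on this item.
-/

noncomputable section

-- `Summit.KontsevichZagierPeriods.KontsevichZagierPeriods.…` is the tree's mandated layout (single-conjunct summit).
set_option linter.dupNamespace false

open MeasureTheory Set

namespace Summit.KontsevichZagierPeriods.KontsevichZagierPeriods.Cruxes.TorsionSectorComplete.Birth

open Literature.NumberTheory.Transcendental
open Literature.NumberTheory.Transcendental.KZ

/-! ### Registered stubs -/

/-- **STUB A (`stub_surfaceDescent`, conjecture-grade) — dimension descent of vanishing rational
pairs modulo the enlarged calculus.** For rational representations `r : KZ.IntegralRep n`,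
`r' : KZ.IntegralRep m` (any `n`, `m`) with `r.value = r'.value` there is an element `y` of the
surface layer `closure {[s] | s : KZ.IntegralRep k, k ≤ 2}` with
`([r] − [r']) − y ∈ KZ.relations ⊔ closure T` (`T` = the tied Néron–torsion elements of the crux,
verbatim). Implied by the crux (`y = 0`, `surfaceDescent_of_crux`); with `stub_surfaceKernel` it
gives the crux (`TorsionSectorComplete_of`). Why it might fail: iff Conjecture 1 (relative to the
sector) fails first in Hodge level `≥ 3` — a vanishing pair of 3-dimensional rational
representations (two formulas for `ζ(3)`; the GKZ pair `J₁`) that no chain of moves brings down to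
the surface layer — while holding inside the layer. Size: conjecture (Grothendieck-strength
rigidity in weight ≥ 3: HuberMullerStach2017 Ch. 13; Ayoub2014; Brown2012 for the MZV sector).
[KontsevichZagier2001 §1.2; HuberMullerStach2017 Prop. 13.2.6] -/
theorem stub_surfaceDescent :
    ∀ ⦃n m : ℕ⦄ (r : Literature.NumberTheory.Transcendental.KZ.IntegralRep n)
      (r' : Literature.NumberTheory.Transcendental.KZ.IntegralRep m),
      r.IsRational → r'.IsRational → r.value = r'.value →
      ∃ y ∈ AddSubgroup.closure {c : Literature.NumberTheory.Transcendental.KZ.FormalRep |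
          ∃ (k : ℕ) (s : Literature.NumberTheory.Transcendental.KZ.IntegralRep k),
            k ≤ 2 ∧ c = Literature.NumberTheory.Transcendental.KZ.of s},
        Literature.NumberTheory.Transcendental.KZ.of r - Literature.NumberTheory.Transcendental.KZ.of r' - y ∈
          Literature.NumberTheory.Transcendental.KZ.relations ⊔ AddSubgroup.closure {d : Literature.NumberTheory.Transcendental.KZ.FormalRep | ∃ (g₂ g₃ e₁ xP yP α : ℝ) (N a : ℕ) (M k m : ℤ) (f : ℝ → ℝ) (rI rP : Literature.NumberTheory.Transcendental.KZ.IntegralRep 2) (rL : Literature.NumberTheory.Transcendental.KZ.IntegralRep 1), (∀ x, f x = 4 * x ^ 3 - g₂ * x - g₃) ∧ g₂ ^ 3 - 27 * g₃ ^ 2 ≠ 0 ∧ f e₁ = 0 ∧ 0 < e₁ ∧ (∀ x, e₁ < x → 0 < f x) ∧ e₁ < xP ∧ yP ^ 2 = f xP ∧ 3 ≤ N ∧ 0 < a ∧ 2 * a < N ∧ 4 * (N : ℤ) ^ 2 * k = M * ((N : ℤ) - 2 * (a : ℤ)) ^ 2 ∧ (∀ hns : (⟨0, 0, 0, -g₂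 / 4, -g₃ / 4⟩ : WeierstrassCurve ℝ).toAffine.Nonsingular xP (yP / 2), addOrderOf (WeierstrassCurve.Affine.Point.some xP (yP / 2) hns) = N) ∧ (N : ℝ) * (∫ x in Set.Ioi xP, (Real.sqrt (f x))⁻¹) = a * (2 * ∫ x in Set.Ioi e₁, (Real.sqrt (f x))⁻¹) ∧ 1 < α ∧ rI.domain = {z | e₁ < z 1 ∧ z 1 < z 0 ∧ z 0 < xP} ∧ Set.EqOn rI.integrand (fun z => z 1 / (Real.sqrt (f (z 1)) * Real.sqrt (f (z 0)))) rI.domain ∧ rP.domain = {z | e₁ < z 0 ∧ e₁ < z 1} ∧ Set.EqOn rP.integrand (fun z => (Real.sqrt (f (z 0)))⁻¹ * ((g₂ * z 1 + 2 * g₃) / (2 * (z 1) ^ 2 * Real.sqrt (f (z 1))))) rP.domain ∧ rL.domain = {t | 1 < t 0 ∧ t 0 < α} ∧ Set.EqOn rL.integrand (fun t => (t 0)⁻¹) rL.domain ∧ (M : ℝ) * rI.value + k * rP.value = m * rL.value ∧ d = M • Literature.NumberTheory.Transcendental.KZ.of rI + k • Literature.NumberTheory.Transcendental.KZ.of rP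 - m • Literature.NumberTheory.Transcendental.KZ.of rL} := by
  sorry

/-- **STUB B (`stub_surfaceKernel`, conjecture-grade) — completeness of the surface-layer calculus
enlarged by the Néron–torsion elements.** Every element of the surface layer
`closure {[s] | s : KZ.IntegralRep k, k ≤ 2}` (formal `ℤ`-combinations of representations of
dimension `≤ 2`, algebraic integrands allowed — the layer containing every tied Néron–torsion
element, `closure_tied_le_surfaceLayer`) whose value is `0` lies in `KZ.relations ⊔ closure T`.
Implied by the crux (`surfaceKernel_of_crux`: merge to a difference of two representations,
rationalise both by the subgraph move, apply the crux — tree facts `exists_integralRep_sub_holds`,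
`exists_isRational_equivalent_holds`); implies the `T`-relative forms of `DimTwoRationalStratum`
(HodgeLevel stmt-4280) and `PlanarAreas` (stmt-4990); its rational dimension-`≤ 1` shadow is the
theorem `LowdimBaker0DimLeOne` (stmt-10622). Why it might fail: one Huber–Wüstholz relation among
real 1-periods (isogeny, correspondence, Cauchy residue) or one depth-2 identity (five-term / Fay,
Milnor–Lobachevsky values) inside the layer that is no chain of real semialgebraic moves even
granted the Néron–torsion elements — it would refute the crux and the summit with it. Size:
conjecture (period conjecture for pairs of dimension ≤ 2 inside the rules).
[KontsevichZagier2001 §1.2; HuberWustholz2022 Thm 13.3; HuberMullerStach2017 Ch. 13] -/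
theorem stub_surfaceKernel :
    ∀ y ∈ AddSubgroup.closure {c : Literature.NumberTheory.Transcendental.KZ.FormalRep |
        ∃ (k : ℕ) (s : Literature.NumberTheory.Transcendental.KZ.IntegralRep k),
          k ≤ 2 ∧ c = Literature.NumberTheory.Transcendental.KZ.of s},
      Literature.NumberTheory.Transcendental.KZ.eval y = 0 →
        y ∈ Literature.NumberTheory.Transcendental.KZ.relations ⊔ AddSubgroup.closure {d : Literature.NumberTheory.Transcendental.KZ.FormalRep | ∃ (g₂ g₃ e₁ xP yP α : ℝ) (N a : ℕ) (M k m : ℤ) (f : ℝ → ℝ) (rI rP : Literature.NumberTheory.Transcendental.KZ.IntegralRep 2) (rL : Literature.NumberTheory.Transcendental.KZ.IntegralRep 1), (∀ x, f x = 4 * x ^ 3 - g₂ * x - g₃) ∧ g₂ ^ 3 - 27 * g₃ ^ 2 ≠ 0 ∧ f e₁ = 0 ∧ 0 < e₁ ∧ (∀ x, e₁ < x → 0 < f x) ∧ e₁ < xP ∧ yP ^ 2 = f xP ∧ 3 ≤ N ∧ 0 < a ∧ 2 * a < N ∧ 4 * (N : ℤ) ^ 2 * k = M * ((N : ℤ)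 - 2 * (a : ℤ)) ^ 2 ∧ (∀ hns : (⟨0, 0, 0, -g₂ / 4, -g₃ / 4⟩ : WeierstrassCurve ℝ).toAffine.Nonsingular xP (yP / 2), addOrderOf (WeierstrassCurve.Affine.Point.some xP (yP / 2) hns) = N) ∧ (N : ℝ) * (∫ x in Set.Ioi xP, (Real.sqrt (f x))⁻¹) = a * (2 * ∫ x in Set.Ioi e₁, (Real.sqrt (f x))⁻¹) ∧ 1 < α ∧ rI.domain = {z | e₁ < z 1 ∧ z 1 < z 0 ∧ z 0 < xP} ∧ Set.EqOn rI.integrand (fun z => z 1 / (Real.sqrt (f (z 1)) * Real.sqrt (f (z 0)))) rI.domain ∧ rP.domain = {z | e₁ < z 0 ∧ e₁ < z 1} ∧ Set.EqOn rP.integrand (fun z => (Real.sqrt (f (z 0)))⁻¹ * ((g₂ * z 1 + 2 * g₃) / (2 * (z 1) ^ 2 * Real.sqrt (f (z 1))))) rP.domain ∧ rL.domain = {t | 1 < t 0 ∧ t 0 < α} ∧ Set.EqOn rL.integrand (fun t => (t 0)⁻¹) rL.domain ∧ (M : ℝ) * rI.value + k * rP.value = m * rL.value ∧ d = M • Literature.NumberTheory.Transcendental.KZ.of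 rI + k • Literature.NumberTheory.Transcendental.KZ.of rP - m • Literature.NumberTheory.Transcendental.KZ.of rL} := by
  sorry

/-! ### Proved infrastructure of the cut (no `sorry` below this line) -/

/-- **Soundness of the sector**: every tied Néron–torsion element evaluates to `0` — its own value
hypothesis `M·I + k·(η₁ω₁/2) = m·log α` is one of the conjuncts. Hence `closure T ≤ ker eval`.
[KontsevichZagier2001 §1.2] -/
theorem closure_tied_le_ker_eval :
    AddSubgroup.closure {d : Literature.NumberTheory.Transcendental.KZ.FormalRep | ∃ (g₂ g₃ e₁ xP yP α : ℝ) (N a : ℕ) (M k m : ℤ) (f : ℝ → ℝ) (rI rP : Literature.NumberTheory.Transcendental.KZ.IntegralRep 2) (rL : Literature.NumberTheory.Transcendental.KZ.IntegralRep 1), (∀ x, f x = 4 * x ^ 3 - g₂ * x - g₃) ∧ g₂ ^ 3 - 27 * g₃ ^ 2 ≠ 0 ∧ f e₁ = 0 ∧ 0 < e₁ ∧ (∀ x, e₁ < x → 0 < f x) ∧ e₁ < xP ∧ yP ^ 2 = f xP ∧ 3 ≤ N ∧ 0 < a ∧ 2 * a < N ∧ 4 * (N : ℤ) ^ 2 *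 k = M * ((N : ℤ) - 2 * (a : ℤ)) ^ 2 ∧ (∀ hns : (⟨0, 0, 0, -g₂ / 4, -g₃ / 4⟩ : WeierstrassCurve ℝ).toAffine.Nonsingular xP (yP / 2), addOrderOf (WeierstrassCurve.Affine.Point.some xP (yP / 2) hns) = N) ∧ (N : ℝ) * (∫ x in Set.Ioi xP, (Real.sqrt (f x))⁻¹) = a * (2 * ∫ x in Set.Ioi e₁, (Real.sqrt (f x))⁻¹) ∧ 1 < α ∧ rI.domain = {z | e₁ < z 1 ∧ z 1 < z 0 ∧ z 0 < xP} ∧ Set.EqOn rI.integrand (fun z => z 1 / (Real.sqrt (f (z 1)) * Real.sqrt (f (z 0)))) rI.domain ∧ rP.domain = {z | e₁ < z 0 ∧ e₁ < z 1} ∧ Set.EqOn rP.integrand (fun z => (Real.sqrt (f (z 0)))⁻¹ * ((g₂ * z 1 + 2 * g₃) / (2 * (z 1) ^ 2 * Real.sqrt (f (z 1))))) rP.domain ∧ rL.domain = {t | 1 < t 0 ∧ t 0 < α} ∧ Set.EqOn rL.integrand (fun t => (t 0)⁻¹) rL.domain ∧ (M : ℝ) * rI.value + k * rP.value = m * rL.value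 ∧ d = M • Literature.NumberTheory.Transcendental.KZ.of rI + k • Literature.NumberTheory.Transcendental.KZ.of rP - m • Literature.NumberTheory.Transcendental.KZ.of rL} ≤ Literature.NumberTheory.Transcendental.KZ.eval.ker := by
  refine (AddSubgroup.closure_le _).mpr ?_
  rintro d ⟨g₂, g₃, e₁, xP, yP, α, N, a, M, k, m', f, rI, rP, rL, _hf, _hdisc, _he, _he0, _hpos, _hx,
    _hy, _hN, _ha, _ha', _htie, _htor, _hρ, _hα, _hdI, _hiI, _hdP, _hiP, _hdL, _hiL, hval, rfl⟩
  show _ ∈ Literature.NumberTheory.Transcendental.KZ.eval.ker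
  rw [AddMonoidHom.mem_ker, map_sub, map_add, map_zsmul, map_zsmul, map_zsmul, eval_of, eval_of,
    eval_of, zsmul_eq_mul, zsmul_eq_mul, zsmul_eq_mul]
  linarith [hval]

/-- **Soundness of the enlarged calculus**: `KZ.relations ⊔ closure T ≤ ker eval` (moves are sound,
`KZ.relations_le_ker_eval_holds`; tied elements by `closure_tied_le_ker_eval`).
[KontsevichZagier2001 §1.2; HuberMullerStach2017 §13.1] -/
theorem enlarged_le_ker_eval :
    Literature.NumberTheory.Transcendental.KZ.relations ⊔ AddSubgroup.closure {d : Literature.NumberTheory.Transcendental.KZ.FormalRep | ∃ (g₂ g₃ e₁ xP yP α : ℝ) (N a : ℕ) (M k m : ℤ) (f : ℝ → ℝ) (rI rP : Literature.NumberTheory.Transcendental.KZ.IntegralRep 2) (rL : Literature.NumberTheory.Transcendental.KZ.IntegralRep 1), (∀ x, f x = 4 * x ^ 3 - g₂ * x - g₃) ∧ g₂ ^ 3 - 27 * g₃ ^ 2 ≠ 0 ∧ f e₁ = 0 ∧ 0 < e₁ ∧ (∀ x, e₁ < x → 0 < f x) ∧ e₁ < xP ∧ yP ^ 2 = f xP ∧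 3 ≤ N ∧ 0 < a ∧ 2 * a < N ∧ 4 * (N : ℤ) ^ 2 * k = M * ((N : ℤ) - 2 * (a : ℤ)) ^ 2 ∧ (∀ hns : (⟨0, 0, 0, -g₂ / 4, -g₃ / 4⟩ : WeierstrassCurve ℝ).toAffine.Nonsingular xP (yP / 2), addOrderOf (WeierstrassCurve.Affine.Point.some xP (yP / 2) hns) = N) ∧ (N : ℝ) * (∫ x in Set.Ioi xP, (Real.sqrt (f x))⁻¹) = a * (2 * ∫ x in Set.Ioi e₁, (Real.sqrt (f x))⁻¹) ∧ 1 < α ∧ rI.domain = {z | e₁ < z 1 ∧ z 1 < z 0 ∧ z 0 < xP} ∧ Set.EqOn rI.integrand (fun z => z 1 / (Real.sqrt (f (z 1)) * Real.sqrt (f (z 0)))) rI.domain ∧ rP.domain = {z | e₁ < z 0 ∧ e₁ < z 1} ∧ Set.EqOn rP.integrand (fun z => (Real.sqrt (f (z 0)))⁻¹ * ((g₂ * z 1 + 2 * g₃) / (2 * (z 1) ^ 2 * Real.sqrt (f (z 1))))) rP.domain ∧ rL.domain = {t | 1 < t 0 ∧ t 0 < α} ∧ Set.EqOn rL.integrand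 (fun t => (t 0)⁻¹) rL.domain ∧ (M : ℝ) * rI.value + k * rP.value = m * rL.value ∧ d = M • Literature.NumberTheory.Transcendental.KZ.of rI + k • Literature.NumberTheory.Transcendental.KZ.of rP - m • Literature.NumberTheory.Transcendental.KZ.of rL} ≤
      Literature.NumberTheory.Transcendental.KZ.eval.ker :=
  sup_le relations_le_ker_eval_holds closure_tied_le_ker_eval

/-- **The sector lives in the surface layer**: every tied Néron–torsion element is a combination of
representations of dimension `≤ 2` (`rI`, `rP` have dimension `2`, `rL` dimension `1`), so
`closure T ≤ closure {[s] | dim s ≤ 2}` — the reason the cut is made at dimension two. [folklore] -/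
theorem closure_tied_le_surfaceLayer :
    AddSubgroup.closure {d : Literature.NumberTheory.Transcendental.KZ.FormalRep | ∃ (g₂ g₃ e₁ xP yP α : ℝ) (N a : ℕ) (M k m : ℤ) (f : ℝ → ℝ) (rI rP : Literature.NumberTheory.Transcendental.KZ.IntegralRep 2) (rL : Literature.NumberTheory.Transcendental.KZ.IntegralRep 1), (∀ x, f x = 4 * x ^ 3 - g₂ * x - g₃) ∧ g₂ ^ 3 - 27 * g₃ ^ 2 ≠ 0 ∧ f e₁ = 0 ∧ 0 < e₁ ∧ (∀ x, e₁ < x → 0 < f x) ∧ e₁ < xP ∧ yP ^ 2 = f xP ∧ 3 ≤ N ∧ 0 < a ∧ 2 * a < N ∧ 4 * (N : ℤ) ^ 2 * k = M * ((N : ℤ) - 2 * (a : ℤ)) ^ 2 ∧ (∀ hns : (⟨0, 0, 0, -g₂ / 4, -g₃ / 4⟩ : WeierstrassCurve ℝ).toAffine.Nonsingular xP (yP / 2), addOrderOf (WeierstrassCurve.Affine.Point.some xP (yP / 2) hns) = N) ∧ (N : ℝ) * (∫ x in Set.Ioi xP, (Real.sqrt (f x))⁻¹) = a * (2 * ∫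 x in Set.Ioi e₁, (Real.sqrt (f x))⁻¹) ∧ 1 < α ∧ rI.domain = {z | e₁ < z 1 ∧ z 1 < z 0 ∧ z 0 < xP} ∧ Set.EqOn rI.integrand (fun z => z 1 / (Real.sqrt (f (z 1)) * Real.sqrt (f (z 0)))) rI.domain ∧ rP.domain = {z | e₁ < z 0 ∧ e₁ < z 1} ∧ Set.EqOn rP.integrand (fun z => (Real.sqrt (f (z 0)))⁻¹ * ((g₂ * z 1 + 2 * g₃) / (2 * (z 1) ^ 2 * Real.sqrt (f (z 1))))) rP.domain ∧ rL.domain = {t | 1 < t 0 ∧ t 0 < α} ∧ Set.EqOn rL.integrand (fun t => (t 0)⁻¹) rL.domain ∧ (M : ℝ) * rI.value + k * rP.value = m * rL.value ∧ d = M • Literature.NumberTheory.Transcendental.KZ.of rI + k • Literature.NumberTheory.Transcendental.KZ.of rP - m • Literature.NumberTheory.Transcendental.KZ.of rL} ≤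
      AddSubgroup.closure {c : Literature.NumberTheory.Transcendental.KZ.FormalRep |
        ∃ (k : ℕ) (s : Literature.NumberTheory.Transcendental.KZ.IntegralRep k),
          k ≤ 2 ∧ c = Literature.NumberTheory.Transcendental.KZ.of s} := by
  refine (AddSubgroup.closure_le _).mpr ?_
  rintro d ⟨g₂, g₃, e₁, xP, yP, α, N, a, M, k, m', f, rI, rP, rL, _hf, _hdisc, _he, _he0, _hpos, _hx,
    _hy, _hN, _ha, _ha', _htie, _htor, _hρ, _hα, _hdI, _hiI, _hdP, _hiP, _hdL, _hiL, _hval, rfl⟩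
  refine AddSubgroup.sub_mem _ (AddSubgroup.add_mem _ ?_ ?_) ?_
  · refine AddSubgroup.zsmul_mem _ (AddSubgroup.subset_closure ?_) M
    exact ⟨2, rI, le_rfl, rfl⟩
  · refine AddSubgroup.zsmul_mem _ (AddSubgroup.subset_closure ?_) k
    exact ⟨2, rP, le_rfl, rfl⟩
  · refine AddSubgroup.zsmul_mem _ (AddSubgroup.subset_closure ?_) m'
    exact ⟨1, rL, by norm_num, rfl⟩

/-- **Stub A is crux-implied** (take `y = 0`): no refutation of `stub_surfaceDescent` short of
refuting the crux, hence the summit (`closes` of the route + refuter's `of_summit`). [folklore] -/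
theorem surfaceDescent_of_crux
    (hC : Summit.KontsevichZagierPeriods.KontsevichZagierPeriods.Theses.TorsionLogs.TorsionSectorComplete) :
    ∀ ⦃n m : ℕ⦄ (r : Literature.NumberTheory.Transcendental.KZ.IntegralRep n)
      (r' : Literature.NumberTheory.Transcendental.KZ.IntegralRep m),
      r.IsRational → r'.IsRational → r.value = r'.value →
      ∃ y ∈ AddSubgroup.closure {c : Literature.NumberTheory.Transcendental.KZ.FormalRep |
          ∃ (k : ℕ) (s : Literature.NumberTheory.Transcendental.KZ.IntegralRep k),
            k ≤ 2 ∧ c = Literature.NumberTheory.Transcendental.KZ.of s},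
        Literature.NumberTheory.Transcendental.KZ.of r - Literature.NumberTheory.Transcendental.KZ.of r' - y ∈
          Literature.NumberTheory.Transcendental.KZ.relations ⊔ AddSubgroup.closure {d : Literature.NumberTheory.Transcendental.KZ.FormalRep | ∃ (g₂ g₃ e₁ xP yP α : ℝ) (N a : ℕ) (M k m : ℤ) (f : ℝ → ℝ) (rI rP : Literature.NumberTheory.Transcendental.KZ.IntegralRep 2) (rL : Literature.NumberTheory.Transcendental.KZ.IntegralRep 1), (∀ x, f x = 4 * x ^ 3 - g₂ * x - g₃) ∧ g₂ ^ 3 - 27 * g₃ ^ 2 ≠ 0 ∧ f e₁ = 0 ∧ 0 < e₁ ∧ (∀ x, e₁ < x → 0 < f x) ∧ e₁ < xP ∧ yP ^ 2 = f xP ∧ 3 ≤ N ∧ 0 < a ∧ 2 * a < N ∧ 4 * (N : ℤ) ^ 2 * k = M * ((N : ℤ) - 2 * (a : ℤ)) ^ 2 ∧ (∀ hns : (⟨0, 0, 0, -g₂ / 4, -g₃ / 4⟩ : WeierstrassCurve ℝ).toAffine.Nonsingular xP (yP / 2), addOrderOf (WeierstrassCurve.Affine.Point.some xP (yP / 2)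 hns) = N) ∧ (N : ℝ) * (∫ x in Set.Ioi xP, (Real.sqrt (f x))⁻¹) = a * (2 * ∫ x in Set.Ioi e₁, (Real.sqrt (f x))⁻¹) ∧ 1 < α ∧ rI.domain = {z | e₁ < z 1 ∧ z 1 < z 0 ∧ z 0 < xP} ∧ Set.EqOn rI.integrand (fun z => z 1 / (Real.sqrt (f (z 1)) * Real.sqrt (f (z 0)))) rI.domain ∧ rP.domain = {z | e₁ < z 0 ∧ e₁ < z 1} ∧ Set.EqOn rP.integrand (fun z => (Real.sqrt (f (z 0)))⁻¹ * ((g₂ * z 1 + 2 * g₃) / (2 * (z 1) ^ 2 * Real.sqrt (f (z 1))))) rP.domain ∧ rL.domain = {t | 1 < t 0 ∧ t 0 < α} ∧ Set.EqOn rL.integrand (fun t => (t 0)⁻¹) rL.domain ∧ (M : ℝ) * rI.value + k * rP.value = m * rL.value ∧ d = M • Literature.NumberTheory.Transcendental.KZ.of rI + k • Literature.NumberTheory.Transcendental.KZ.of rP - m • Literature.NumberTheory.Transcendental.KZ.of rL} := by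
  intro n m r r' hr hr' hv
  exact ⟨0, AddSubgroup.zero_mem _, by simpa using hC r r' hr hr' hv⟩

/-- **Stub B is crux-implied** (in fact for every formal combination of value `0`, not only the
surface layer): merge `y ≡ [r] − [r']` (`exists_integralRep_sub_holds`), rationalise
`r ~ r₁`, `r' ~ r₁'` (`exists_isRational_equivalent_holds`), read `r₁.value = r₁'.value` off
soundness (`relations_le_ker_eval_holds`), apply the crux to the rational pair and climb back
through `relations ≤ relations ⊔ closure T`. So `stub_surfaceKernel` is refutable only by refuting
the crux, hence the summit. [KontsevichZagier2001 §1.1 (remark) and §1.2] -/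
theorem surfaceKernel_of_crux
    (hC : Summit.KontsevichZagierPeriods.KontsevichZagierPeriods.Theses.TorsionLogs.TorsionSectorComplete) :
    ∀ y ∈ AddSubgroup.closure {c : Literature.NumberTheory.Transcendental.KZ.FormalRep |
        ∃ (k : ℕ) (s : Literature.NumberTheory.Transcendental.KZ.IntegralRep k),
          k ≤ 2 ∧ c = Literature.NumberTheory.Transcendental.KZ.of s},
      Literature.NumberTheory.Transcendental.KZ.eval y = 0 →
        y ∈ Literature.NumberTheory.Transcendental.KZ.relations ⊔ AddSubgroup.closure {d : Literature.NumberTheory.Transcendental.KZ.FormalRep | ∃ (g₂ g₃ e₁ xP yP α : ℝ) (N a : ℕ) (M k m : ℤ) (f : ℝ → ℝ) (rI rP : Literature.NumberTheory.Transcendental.KZ.IntegralRep 2) (rL : Literature.NumberTheory.Transcendental.KZ.IntegralRep 1), (∀ x, f x = 4 * x ^ 3 - g₂ * x - g₃) ∧ g₂ ^ 3 - 27 * g₃ ^ 2 ≠ 0 ∧ f e₁ = 0 ∧ 0 < e₁ ∧ (∀ x, e₁ < x → 0 < f x) ∧ e₁ < xP ∧ yP ^ 2 = f xP ∧ 3 ≤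 N ∧ 0 < a ∧ 2 * a < N ∧ 4 * (N : ℤ) ^ 2 * k = M * ((N : ℤ) - 2 * (a : ℤ)) ^ 2 ∧ (∀ hns : (⟨0, 0, 0, -g₂ / 4, -g₃ / 4⟩ : WeierstrassCurve ℝ).toAffine.Nonsingular xP (yP / 2), addOrderOf (WeierstrassCurve.Affine.Point.some xP (yP / 2) hns) = N) ∧ (N : ℝ) * (∫ x in Set.Ioi xP, (Real.sqrt (f x))⁻¹) = a * (2 * ∫ x in Set.Ioi e₁, (Real.sqrt (f x))⁻¹) ∧ 1 < α ∧ rI.domain = {z | e₁ < z 1 ∧ z 1 < z 0 ∧ z 0 < xP} ∧ Set.EqOn rI.integrand (fun z => z 1 / (Real.sqrt (f (z 1)) * Real.sqrt (f (z 0)))) rI.domain ∧ rP.domain = {z | e₁ < z 0 ∧ e₁ < z 1} ∧ Set.EqOn rP.integrand (fun z => (Real.sqrt (f (z 0)))⁻¹ * ((g₂ * z 1 + 2 * g₃) / (2 * (z 1) ^ 2 * Real.sqrt (f (z 1))))) rP.domain ∧ rL.domain = {t | 1 < t 0 ∧ t 0 < α} ∧ Set.EqOn rL.integrand (fun t =>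 (t 0)⁻¹) rL.domain ∧ (M : ℝ) * rI.value + k * rP.value = m * rL.value ∧ d = M • Literature.NumberTheory.Transcendental.KZ.of rI + k • Literature.NumberTheory.Transcendental.KZ.of rP - m • Literature.NumberTheory.Transcendental.KZ.of rL} := by
  intro y _hy hy0
  set H : AddSubgroup Literature.NumberTheory.Transcendental.KZ.FormalRep :=
    Literature.NumberTheory.Transcendental.KZ.relations ⊔ AddSubgroup.closure {d : Literature.NumberTheory.Transcendental.KZ.FormalRep | ∃ (g₂ g₃ e₁ xP yP α : ℝ) (N a : ℕ) (M k m : ℤ) (f : ℝ → ℝ) (rI rP : Literature.NumberTheory.Transcendental.KZ.IntegralRep 2) (rL : Literature.NumberTheory.Transcendental.KZ.IntegralRep 1), (∀ x, f x = 4 * x ^ 3 - g₂ * x - g₃) ∧ g₂ ^ 3 - 27 * g₃ ^ 2 ≠ 0 ∧ f e₁ = 0 ∧ 0 < e₁ ∧ (∀ x, e₁ < x → 0 < f x) ∧ e₁ < xP ∧ yP ^ 2 = f xP ∧ 3 ≤ N ∧ 0 < a ∧ 2 * a < N ∧ 4 * (N : ℤ) ^ 2 * k = M * ((N : ℤ)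 - 2 * (a : ℤ)) ^ 2 ∧ (∀ hns : (⟨0, 0, 0, -g₂ / 4, -g₃ / 4⟩ : WeierstrassCurve ℝ).toAffine.Nonsingular xP (yP / 2), addOrderOf (WeierstrassCurve.Affine.Point.some xP (yP / 2) hns) = N) ∧ (N : ℝ) * (∫ x in Set.Ioi xP, (Real.sqrt (f x))⁻¹) = a * (2 * ∫ x in Set.Ioi e₁, (Real.sqrt (f x))⁻¹) ∧ 1 < α ∧ rI.domain = {z | e₁ < z 1 ∧ z 1 < z 0 ∧ z 0 < xP} ∧ Set.EqOn rI.integrand (fun z => z 1 / (Real.sqrt (f (z 1)) * Real.sqrt (f (z 0)))) rI.domain ∧ rP.domain = {z | e₁ < z 0 ∧ e₁ < z 1} ∧ Set.EqOn rP.integrand (fun z => (Real.sqrt (f (z 0)))⁻¹ * ((g₂ * z 1 + 2 * g₃) / (2 * (z 1) ^ 2 * Real.sqrt (f (z 1))))) rP.domain ∧ rL.domain = {t | 1 < t 0 ∧ t 0 < α} ∧ Set.EqOn rL.integrand (fun t => (t 0)⁻¹) rL.domain ∧ (M : ℝ) * rI.value + k * rP.value = m * rL.value ∧ d = M • Literature.NumberTheory.Transcendental.KZ.of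 rI + k • Literature.NumberTheory.Transcendental.KZ.of rP - m • Literature.NumberTheory.Transcendental.KZ.of rL} with hH
  have hRel : Literature.NumberTheory.Transcendental.KZ.relations ≤ H := le_sup_left
  -- merge: `y ≡ [r] − [r']` modulo moves
  obtain ⟨n, m, r, r', hmerge⟩ := exists_integralRep_sub_holds y
  -- rationalise both ends: `r ~ r₁`, `r' ~ r₁'` with `r₁`, `r₁'` of KZ's literal rational shape
  obtain ⟨n₁, r₁, hr₁, he₁⟩ := exists_isRational_equivalent_holds r
  obtain ⟨m₁, r₁', hr₁', he₁'⟩ := exists_isRational_equivalent_holds r'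
  -- the rational pair has value difference `eval y = 0`
  have hdiff : y - (of r₁ - of r₁') ∈ Literature.NumberTheory.Transcendental.KZ.relations := by
    have : y - (of r₁ - of r₁') = (y - (of r - of r')) + (of r - of r₁) - (of r' - of r₁') := by abel
    rw [this]
    exact relations.sub_mem (relations.add_mem hmerge he₁) he₁'
  have hv : r₁.value = r₁'.value := by
    have h0 : Literature.NumberTheory.Transcendental.KZ.eval (y - (of r₁ - of r₁')) = 0 :=
      relations_le_ker_eval_holds hdiff
    rw [map_sub, map_sub, eval_of, eval_of, hy0, zero_sub, neg_sub, sub_eq_zero] at h0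
    exact h0.symm
  -- the crux on the rational pair, then climb back
  have hpair : of r₁ - of r₁' ∈ H := hC r₁ r₁' hr₁ hr₁' hv
  have : y = (y - (of r₁ - of r₁')) + (of r₁ - of r₁') := by abel
  rw [this]
  exact H.add_mem (hRel hdiff) hpair

/-! ### Composition (the registered implication, kernel-checked) -/

/-- **Composition: the crux BY NAME from the two stubs.** The `suffices` is the registered
implication `<stub_surfaceDescent> → <stub_surfaceKernel> → TorsionSectorComplete` (closed term, no
`sorry` of its own), applied to the two named stubs. Proof of the implication: for rational `r`,
`r'` of equal value put `x = [r] − [r']`, so `eval x = 0`; descent gives `y` in the surface layer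
with `x − y ∈ relations ⊔ closure T`; soundness of the ENLARGED calculus (`enlarged_le_ker_eval`)
gives `eval y = eval x = 0`; the surface kernel gives `y ∈ relations ⊔ closure T`; hence
`x = (x − y) + y ∈ relations ⊔ closure T`. Axioms: the Mathlib whitelist plus `sorryAx` through the
two stubs only. [KontsevichZagier2001 §1.2] -/
theorem TorsionSectorComplete_of :
    Summit.KontsevichZagierPeriods.KontsevichZagierPeriods.Theses.TorsionLogs.TorsionSectorComplete := by
  suffices key :
      (∀ ⦃n m : ℕ⦄ (r : Literature.NumberTheory.Transcendental.KZ.IntegralRep n)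
        (r' : Literature.NumberTheory.Transcendental.KZ.IntegralRep m),
        r.IsRational → r'.IsRational → r.value = r'.value →
        ∃ y ∈ AddSubgroup.closure {c : Literature.NumberTheory.Transcendental.KZ.FormalRep |
          ∃ (k : ℕ) (s : Literature.NumberTheory.Transcendental.KZ.IntegralRep k),
          k ≤ 2 ∧ c = Literature.NumberTheory.Transcendental.KZ.of s},
        Literature.NumberTheory.Transcendental.KZ.of r - Literature.NumberTheory.Transcendental.KZ.of r' - y ∈
        Literature.NumberTheory.Transcendental.KZ.relations ⊔ AddSubgroup.closure {d : Literature.NumberTheory.Transcendental.KZ.FormalRep | ∃ (g₂ g₃ e₁ xP yP α : ℝ) (N a : ℕ) (M k m : ℤ) (f : ℝ → ℝ) (rI rP : Literature.NumberTheory.Transcendental.KZ.IntegralRep 2) (rL : Literature.NumberTheory.Transcendental.KZ.IntegralRep 1), (∀ x, f x = 4 * x ^ 3 - g₂ * x - g₃) ∧ g₂ ^ 3 - 27 * g₃ ^ 2 ≠ 0 ∧ f e₁ = 0 ∧ 0 < e₁ ∧ (∀ x, e₁ < x → 0 < f x) ∧ e₁ < xP ∧ yP ^ 2 = f xP ∧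 3 ≤ N ∧ 0 < a ∧ 2 * a < N ∧ 4 * (N : ℤ) ^ 2 * k = M * ((N : ℤ) - 2 * (a : ℤ)) ^ 2 ∧ (∀ hns : (⟨0, 0, 0, -g₂ / 4, -g₃ / 4⟩ : WeierstrassCurve ℝ).toAffine.Nonsingular xP (yP / 2), addOrderOf (WeierstrassCurve.Affine.Point.some xP (yP / 2) hns) = N) ∧ (N : ℝ) * (∫ x in Set.Ioi xP, (Real.sqrt (f x))⁻¹) = a * (2 * ∫ x in Set.Ioi e₁, (Real.sqrt (f x))⁻¹) ∧ 1 < α ∧ rI.domain = {z | e₁ < z 1 ∧ z 1 < z 0 ∧ z 0 < xP} ∧ Set.EqOn rI.integrand (fun z => z 1 / (Real.sqrt (f (z 1)) * Real.sqrt (f (z 0)))) rI.domain ∧ rP.domain = {z | e₁ < z 0 ∧ e₁ < z 1} ∧ Set.EqOn rP.integrand (fun z => (Real.sqrt (f (z 0)))⁻¹ * ((g₂ * z 1 + 2 * g₃) / (2 * (z 1) ^ 2 * Real.sqrt (f (z 1))))) rP.domain ∧ rL.domain = {t | 1 < t 0 ∧ t 0 < α} ∧ Set.EqOn rL.integrand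 (fun t => (t 0)⁻¹) rL.domain ∧ (M : ℝ) * rI.value + k * rP.value = m * rL.value ∧ d = M • Literature.NumberTheory.Transcendental.KZ.of rI + k • Literature.NumberTheory.Transcendental.KZ.of rP - m • Literature.NumberTheory.Transcendental.KZ.of rL}) →
      (∀ y ∈ AddSubgroup.closure {c : Literature.NumberTheory.Transcendental.KZ.FormalRep |
          ∃ (k : ℕ) (s : Literature.NumberTheory.Transcendental.KZ.IntegralRep k),
          k ≤ 2 ∧ c = Literature.NumberTheory.Transcendental.KZ.of s},
        Literature.NumberTheory.Transcendental.KZ.eval y = 0 →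
        y ∈ Literature.NumberTheory.Transcendental.KZ.relations ⊔ AddSubgroup.closure {d : Literature.NumberTheory.Transcendental.KZ.FormalRep | ∃ (g₂ g₃ e₁ xP yP α : ℝ) (N a : ℕ) (M k m : ℤ) (f : ℝ → ℝ) (rI rP : Literature.NumberTheory.Transcendental.KZ.IntegralRep 2) (rL : Literature.NumberTheory.Transcendental.KZ.IntegralRep 1), (∀ x, f x = 4 * x ^ 3 - g₂ * x - g₃) ∧ g₂ ^ 3 - 27 * g₃ ^ 2 ≠ 0 ∧ f e₁ = 0 ∧ 0 < e₁ ∧ (∀ x, e₁ < x → 0 < f x) ∧ e₁ < xP ∧ yP ^ 2 = f xP ∧ 3 ≤ N ∧ 0 < a ∧ 2 * a < N ∧ 4 * (N : ℤ) ^ 2 * k = M * ((N : ℤ) - 2 * (a : ℤ)) ^ 2 ∧ (∀ hns : (⟨0, 0, 0, -g₂ / 4, -g₃ / 4⟩ : WeierstrassCurve ℝ).toAffine.Nonsingular xP (yP / 2), addOrderOf (WeierstrassCurve.Affine.Point.some xP (yP / 2) hns) = N) ∧ (N : ℝ) * (∫ x in Set.Ioi xP, (Real.sqrt (f x))⁻¹)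 = a * (2 * ∫ x in Set.Ioi e₁, (Real.sqrt (f x))⁻¹) ∧ 1 < α ∧ rI.domain = {z | e₁ < z 1 ∧ z 1 < z 0 ∧ z 0 < xP} ∧ Set.EqOn rI.integrand (fun z => z 1 / (Real.sqrt (f (z 1)) * Real.sqrt (f (z 0)))) rI.domain ∧ rP.domain = {z | e₁ < z 0 ∧ e₁ < z 1} ∧ Set.EqOn rP.integrand (fun z => (Real.sqrt (f (z 0)))⁻¹ * ((g₂ * z 1 + 2 * g₃) / (2 * (z 1) ^ 2 * Real.sqrt (f (z 1))))) rP.domain ∧ rL.domain = {t | 1 < t 0 ∧ t 0 < α} ∧ Set.EqOn rL.integrand (fun t => (t 0)⁻¹) rL.domain ∧ (M : ℝ) * rI.value + k * rP.value = m * rL.value ∧ d = M • Literature.NumberTheory.Transcendental.KZ.of rI + k • Literature.NumberTheory.Transcendental.KZ.of rP - m • Literature.NumberTheory.Transcendental.KZ.of rL}) →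
      Summit.KontsevichZagierPeriods.KontsevichZagierPeriods.Theses.TorsionLogs.TorsionSectorComplete from
    key stub_surfaceDescent stub_surfaceKernel
  intro hA hB n m r r' hr hr' hv
  -- descent to the surface layer
  obtain ⟨y, hy, hxy⟩ := hA r r' hr hr' hv
  -- the pair vanishes
  have hx0 : Literature.NumberTheory.Transcendental.KZ.eval (of r - of r') = 0 := by
    rw [map_sub, eval_of, eval_of, hv, sub_self]
  -- soundness of the enlarged calculus: the surface remainder vanishes too
  have hy0 : Literature.NumberTheory.Transcendental.KZ.eval y = 0 := by
    have h : Literature.NumberTheory.Transcendental.KZ.eval (of r - of r' - y) = 0 := enlarged_le_ker_eval hxy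
    rwa [map_sub, hx0, zero_sub, neg_eq_zero] at h
  -- the surface kernel, then climb back
  have hyH := hB y hy hy0
  have : of r - of r' = (of r - of r' - y) + y := by abel
  rw [this]
  exact AddSubgroup.add_mem _ hxy hyH

end Summit.KontsevichZagierPeriods.KontsevichZagierPeriods.Cruxes.TorsionSectorComplete.Birth
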